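import Mathlib
import Literature.NumberTheory.LFunctions.Zhang2022.Section15BLocalEstimates
import Literature.NumberTheory.LFunctions.Zhang2022.AppendixAKappa2PrimePowers
import HarnessLib

/-!
# Zhang (2022), §15 p. 84: the local factor of `𝓜₁(d,l;s)` at a prime `q ∤ dl` is
# `1 + O(q^{−19/10})` for `σ > 9/10` — `§15.u032` discharged (a second-order cancellation)

Topic `Literature/NumberTheory/LFunctions/Zhang2022` (Landau–Siegel audit tree; verdict-neutral).
Y. Zhang, *Discrete mean estimates and the Landau–Siegel zero*, arXiv:2211.02515v1 (2022)
[Zhang2022LandauSiegel] — **an unrefereed manuscript under adjudication; nothing here asserts or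
denies its Theorems 1–2.** Campaign D-0069, DAG node `Z22:§15.u032` [Z22 p.84, tex L4195–L4201]:

> If `(q,dl) = 1`, then `ξ₁(q;d,l) = … = q^{−β₁} + q^{−β₂} − 1 − χ(q) + O(1/q)`, so that
> `(1−q^{−s−β₁})(1−q^{−s−β₂})(1−q^{−s})⁻¹(1−χ(q)q^{−s})⁻¹(1 + λ̃₁(q,d)Σ_r ξ₁(qʳ;d,l)q^{−rs})
>  = 1 + O(q^{−19/10})` for `σ > 9/10`.

This file PROVES the typed node `Step15_u032` OUTRIGHT (theorems only; no new definitions, no facts;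
hypothesis (A) is not used). Write `x = q^{−s}` (`|x| = q^{−σ}`), `a = q^{−β₁}`, `b = q^{−β₂}`
(unimodular), `v = χ(q)`. The first-order information `ξ₁(q) = a + b − 1 − v + O(1/q)` (the tree's
`step15_u031_holds`) only gives `1 + O(q^{−σ−1} + q^{−2σ}) = 1 + O(q^{−9/5})`; the printed exponent
`19/10` is nevertheless TRUE, by a second-order cancellation: with
`ξ₁(q²;d,l) = κ₁(q²) − χ(q)q(q−1)⁻¹κ₁(q) + O(1/q) = a² + ab + b² − a − b − v(a + b − 1) + O(1/q)`
(`κ₁(q²) = a² + ab + b² − a − b`, `κ̃₁(q;dq) = κ₁(q)`), the `x²`-coefficient of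
`(1−ax)(1−bx)(1 + Σ_r ξ₁(qʳ)xʳ) − (1−x)(1−vx)` is
`(ab − v) + ξ₁(q²) − (a+b)ξ₁(q) = O(1/q)` — the `O(1)` part VANISHES IDENTICALLY — so the whole
difference is `O(q^{−1−σ} + q^{−3σ}) = O(q^{−19/10})` on `σ > 9/10` (`λ̃₁(q,d) = 1 + O(1/q)` and the
tail `Σ_{r≥3}` is `O(q^{−3σ})`).

* `norm_lam1_prime_one_sub_one_le`, `norm_lamTilde1_prime_sub_one_le` — `|λ₁(q) − 1|`,
  `|λ̃₁(q,d) − 1| ≤ 8/q`;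
* `kappa1_prime_sq` — `κ₁(q²) = a² + ab + b² − a − b`;
* `norm_xi1_prime_sq_sub_le` — `ξ₁(q²;d,l) = a² + ab + b² − a − b − v(a+b−1) + O(1/q)` for
  `(q,dl) = 1` (constant `16Z₂ + 6`);
* `xi1LocalSeries_eq_split3` — `Σ_{r≥1}ξ₁(qʳ)q^{−rs} = ξ₁(q)x + ξ₁(q²)x² + R₃`, `|R₃| ≤ 256Z₂Z₃q^{−3σ}`;
* **`step15_u032_holds : Step15_u032 c′`** (constant `16(A₁ + A₃)`, see the proof).

With `step15_u033_holds` (`Section15BLocalEstimates`) and `step15_u034an_of`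
(`Section15BCalM1Analytic`) this makes the analyticity of `𝓜₁(d,l;s)` on `σ > 9/10`
(`Step15_u034an`) unconditional, and (A.4) (`AppendixAEqA4.eqA_4_of`) rests on `Step15_u034` alone.

WHAT THIS IS NOT: anything about Theorems 1–2 / Landau–Siegel zeros.

## References

* Y. Zhang, arXiv:2211.02515v1 (2022), §15 p. 84. [cite: Zhang2022LandauSiegel, §15 p. 84]
-/

noncomputable section

open Complex Real Filter Topology

namespace Literature.NumberTheory.LFunctions.Zhang2022.Typed.Section15B

open Literature.NumberTheory.LFunctions.Zhang2022
open Literature.NumberTheory.LFunctions.Zhang2022.Typed.Section15A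

/-! ## Elementary facts -/

/-- `‖(q:ℂ) − 1‖ = q − 1` for `q ≥ 1`. [folklore] -/
private theorem norm_natCast_sub_one {q : ℕ} (hq : 1 ≤ q) : ‖(q : ℂ) - 1‖ = (q : ℝ) - 1 := by
  have hq' : (1 : ℝ) ≤ q := by exact_mod_cast hq
  have : (q : ℂ) - 1 = (((q : ℝ) - 1 : ℝ) : ℂ) := by push_cast; ring
  rw [this, Complex.norm_real, Real.norm_eq_abs, abs_of_nonneg (by linarith)]

/-- `‖q^{−β₁}‖ = 1` (`β₁` purely imaginary). [cite: Zhang2022LandauSiegel, §2 (2.13)] -/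
private theorem norm_cpow_neg_beta1 (c' : ℝ) (D : ℕ) {q : ℕ} (hq : 0 < q) :
    ‖(q : ℂ) ^ (-Skeleton.beta1 c' D)‖ = 1 := by
  rw [Complex.norm_natCast_cpow_of_pos hq, neg_re, beta1_eq_b1_mul_I]
  simp

/-- `‖q^{−β₂}‖ = 1`. [cite: Zhang2022LandauSiegel, §2 (2.13)] -/
private theorem norm_cpow_neg_beta2 (c' : ℝ) (D : ℕ) {q : ℕ} (hq : 0 < q) :
    ‖(q : ℂ) ^ (-Skeleton.beta2 c' D)‖ = 1 := by
  rw [Complex.norm_natCast_cpow_of_pos hq, neg_re, beta2_eq_b2_mul_I]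
  simp

/-! ## `λ̃₁(q,d) = 1 + O(1/q)` -/

/-- **`|λ₁(q) − 1| ≤ 8/q`** at a prime `q`: `λ₁(q) − 1 = (−vq^{−1−β₁} − vq^{−1−β₂} + v²q^{−2−β₁−β₂}
+ vq^{−1})/(1 − vq^{−1})` (`v = χ(q)`), numerator at most `4/q`, denominator at least `1/2`.
[cite: Zhang2022LandauSiegel, §15 (15.10) p. 82] -/
theorem norm_lam1_prime_one_sub_one_le (c' : ℝ) {D : ℕ} (χ : DirichletCharacter ℂ D) {q : ℕ}
    (hq : q.Prime) : ‖lam1 c' χ q 1 - 1‖ ≤ 8 / q := by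
  have hq0 : (0 : ℝ) < q := by exact_mod_cast hq.pos
  have hq2 : (2 : ℝ) ≤ q := by exact_mod_cast hq.two_le
  set v : ℂ := χ (q : ZMod D) with hvdef
  have hv : ‖v‖ ≤ 1 := DirichletCharacter.norm_le_one χ _
  set u : ℂ := (q : ℂ) ^ (-(1 : ℂ)) with hu
  set u₁ : ℂ := (q : ℂ) ^ (-(1 + Skeleton.beta1 c' D)) with hu₁
  set u₂ : ℂ := (q : ℂ) ^ (-(1 + Skeleton.beta2 c' D)) with hu₂
  have hun : ‖u‖ = 1 / q := by
    rw [hu, Complex.norm_natCast_cpow_of_pos hq.pos]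
    simp [Real.rpow_neg_one]
  have hw : ∀ β : ℂ, β.re = 0 → ‖(q : ℂ) ^ (-(1 + β))‖ = 1 / q := by
    intro β hβ
    rw [Complex.norm_natCast_cpow_of_pos hq.pos]
    have : (-(1 + β)).re = -(1 : ℝ) := by simp [hβ]
    rw [this, Real.rpow_neg_one, one_div]
  have hβ1 : (Skeleton.beta1 c' D).re = 0 := by rw [beta1_eq_b1_mul_I]; simp
  have hβ2 : (Skeleton.beta2 c' D).re = 0 := by rw [beta2_eq_b2_mul_I]; simp
  have hu₁n : ‖u₁‖ = 1 / q := hw _ hβ1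
  have hu₂n : ‖u₂‖ = 1 / q := hw _ hβ2
  have hq1 : 1 / (q : ℝ) ≤ 1 / 2 := by
    rw [one_div, one_div]; exact inv_anti₀ (by norm_num) hq2
  -- denominator
  have hden : 1 / 2 ≤ ‖1 - v * u‖ := by
    have h1 : ‖v * u‖ ≤ 1 / 2 := by
      rw [norm_mul, hun]
      calc ‖v‖ * (1 / q) ≤ 1 * (1 / 2) := by gcongr
        _ = 1 / 2 := one_mul _
    have := norm_sub_norm_le (1 : ℂ) (v * u)
    rw [norm_one] at this
    linarith
  have hden0 : 1 - v * u ≠ 0 := by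
    intro h; rw [h, norm_zero] at hden; linarith
  -- the formula
  have hlam : lam1 c' χ q 1 = (1 - v * u₁) * (1 - v * u₂) / (1 - v * u) := by
    unfold lam1
    rw [hq.primeFactors, Finset.prod_singleton]
  rw [hlam, div_sub_one hden0, norm_div]
  have hnum : ‖(1 - v * u₁) * (1 - v * u₂) - (1 - v * u)‖ ≤ 4 / q := by
    have e : (1 - v * u₁) * (1 - v * u₂) - (1 - v * u) =
        -(v * u₁) + (-(v * u₂)) + v * u₁ * (v * u₂) + v * u := by ring
    rw [e]
    have h1 : ‖-(v * u₁)‖ ≤ 1 / q := by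
      rw [norm_neg, norm_mul, hu₁n]
      calc ‖v‖ * (1 / q) ≤ 1 * (1 / q) := by gcongr
        _ = 1 / q := one_mul _
    have h2 : ‖-(v * u₂)‖ ≤ 1 / q := by
      rw [norm_neg, norm_mul, hu₂n]
      calc ‖v‖ * (1 / q) ≤ 1 * (1 / q) := by gcongr
        _ = 1 / q := one_mul _
    have h3 : ‖v * u₁ * (v * u₂)‖ ≤ 1 / q := by
      rw [norm_mul, norm_mul, norm_mul, hu₁n, hu₂n]
      calc ‖v‖ * (1 / q) * (‖v‖ * (1 / q)) ≤ 1 * (1 / q) * (1 * (1 / 2)) := by gcongr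
        _ ≤ 1 / q := by
          have : (0 : ℝ) ≤ 1 / q := by positivity
          nlinarith
    have h4 : ‖v * u‖ ≤ 1 / q := by
      rw [norm_mul, hun]
      calc ‖v‖ * (1 / q) ≤ 1 * (1 / q) := by gcongr
        _ = 1 / q := one_mul _
    calc ‖-(v * u₁) + (-(v * u₂)) + v * u₁ * (v * u₂) + v * u‖
        ≤ ‖-(v * u₁)‖ + ‖-(v * u₂)‖ + ‖v * u₁ * (v * u₂)‖ + ‖v * u‖ := by
          refine (norm_add_le _ _).trans ?_
          gcongr
          refine (norm_add_le _ _).trans ?_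
          gcongr
          exact norm_add_le _ _
      _ ≤ 1 / q + 1 / q + 1 / q + 1 / q := by gcongr
      _ = 4 / q := by ring
  have hpos : 0 < ‖1 - v * u‖ := by linarith
  rw [div_le_iff₀ hpos]
  calc ‖(1 - v * u₁) * (1 - v * u₂) - (1 - v * u)‖ ≤ 4 / q := hnum
    _ = 8 / q * (1 / 2) := by ring
    _ ≤ 8 / q * ‖1 - v * u‖ := by gcongr

/-- **`|λ̃₁(q,d) − 1| ≤ 8/q`** at a prime `q` (`λ̃₁(q,d) = λ₁(q)` if `(q,d) = 1`, else `1`).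
[cite: Zhang2022LandauSiegel, §15 p. 83 (definition of λ̃₁)] -/
theorem norm_lamTilde1_prime_sub_one_le (c' : ℝ) {D : ℕ} (χ : DirichletCharacter ℂ D) {q : ℕ}
    (hq : q.Prime) (d : ℕ) : ‖lamTilde1 c' χ q d - 1‖ ≤ 8 / q := by
  unfold lamTilde1
  rw [hq.primeFactors, Finset.filter_singleton]
  split_ifs
  · rw [Finset.prod_singleton]; exact norm_lam1_prime_one_sub_one_le c' χ hq
  · rw [Finset.prod_empty, sub_self, norm_zero]; positivity

/-! ## `κ₁(q²)` -/

/-- **`κ₁(q²) = q^{−2β₁} + q^{−β₁}q^{−β₂} + q^{−2β₂} − q^{−β₁} − q^{−β₂}`** at a prime `q`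
(`κ₁ = n^{−β₁} ∗ n^{−β₂} ∗ μ`: `κ₁(q²) = c₁₂(q²) − c₁₂(q)` with `c₁₂(q^k) = Σ_{i≤k} q^{−iβ₁}q^{−(k−i)β₂}`).
[cite: Zhang2022LandauSiegel, §15 p. 81 (definition of κ₁)] -/
theorem kappa1_prime_sq (c' : ℝ) {D : ℕ} {q : ℕ} (hq : q.Prime) :
    kappa1 c' D (q ^ 2) =
      (q : ℂ) ^ (-Skeleton.beta1 c' D) * (q : ℂ) ^ (-Skeleton.beta1 c' D) +
        (q : ℂ) ^ (-Skeleton.beta1 c' D) * (q : ℂ) ^ (-Skeleton.beta2 c' D) +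
        (q : ℂ) ^ (-Skeleton.beta2 c' D) * (q : ℂ) ^ (-Skeleton.beta2 c' D) -
        (q : ℂ) ^ (-Skeleton.beta1 c' D) - (q : ℂ) ^ (-Skeleton.beta2 c' D) := by
  set a : ℂ := (q : ℂ) ^ (-Skeleton.beta1 c' D) with ha
  set b : ℂ := (q : ℂ) ^ (-Skeleton.beta2 c' D) with hb
  have hpa : MeanSquareMajorant.powI (Skeleton.b1 c' D) q = a := by
    rw [MeanSquareMajorant.powI_apply_of_ne_zero _ hq.ne_zero, ha, beta1_eq_b1_mul_I]
  have hpb : MeanSquareMajorant.powI (Skeleton.b2 c' D) q = b := by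
    rw [MeanSquareMajorant.powI_apply_of_ne_zero _ hq.ne_zero, hb, beta2_eq_b2_mul_I]
  have hpa' : ∀ i : ℕ, MeanSquareMajorant.powI (Skeleton.b1 c' D) (q ^ i) = a ^ i := fun i => by
    rw [AppendixA.powI_prime_pow _ hq.ne_zero, hpa]
  have hpb' : ∀ i : ℕ, MeanSquareMajorant.powI (Skeleton.b2 c' D) (q ^ i) = b ^ i := fun i => by
    rw [AppendixA.powI_prime_pow _ hq.ne_zero, hpb]
  have hc12 : ∀ k : ℕ, (MeanSquareMajorant.powI (Skeleton.b1 c' D) *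
      MeanSquareMajorant.powI (Skeleton.b2 c' D)) (q ^ k) =
        ∑ i ∈ Finset.range (k + 1), a ^ i * b ^ (k - i) := fun k => by
    rw [RankinEisenstein.mul_apply_prime_pow _ _ hq k]
    exact Finset.sum_congr rfl fun i _ => by rw [hpa', hpb']
  have hμ : ∀ j : ℕ, (ArithmeticFunction.moebius : ArithmeticFunction ℂ) (q ^ j) =
      if j = 0 then 1 else if j = 1 then -1 else 0 := fun j => by
    rw [ArithmeticFunction.intCoe_apply]
    rcases Nat.eq_zero_or_pos j with rfl | hj
    · simp
    · rw [ArithmeticFunction.moebius_apply_prime_pow hq hj.ne', if_neg hj.ne']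
      split_ifs <;> simp
  unfold kappa1 MeanSquareMajorant.kappa₁
  rw [RankinEisenstein.mul_apply_prime_pow _ _ hq 2]
  simp only [Finset.sum_range_succ, Finset.sum_range_zero, hc12, hμ]
  norm_num
  ring

/-! ## `ξ₁(q²;d,l)` for `(q,dl) = 1` -/

/-- `Σ_k (k+1)² 2^{−k}` converges. [folklore] -/
private theorem summable_sq_geom' : Summable (fun k : ℕ => ((k : ℝ) + 1) ^ 2 * (1 / 2 : ℝ) ^ k) := by
  have h : Summable (fun n : ℕ => (n : ℝ) ^ 2 * (1 / 2 : ℝ) ^ n) :=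
    summable_pow_mul_geometric_of_norm_lt_one 2 (by norm_num)
  have h2 : Summable (fun n : ℕ => (((n + 1 : ℕ) : ℝ)) ^ 2 * (1 / 2 : ℝ) ^ (n + 1)) :=
    (summable_nat_add_iff 1).mpr h
  refine (h2.mul_left 2).congr fun n => ?_
  push_cast
  rw [pow_succ]
  ring

/-- **`ξ₁(q²;d,l) = q^{−2β₁} + q^{−β₁−β₂} + q^{−2β₂} − q^{−β₁} − q^{−β₂} − χ(q)(q^{−β₁} + q^{−β₂} − 1)
+ O(1/q)`** for a prime `q` with `(q,dl) = 1`, quantitatively with the absolute constant `16Z₂ + 6`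
(`Z₂ = Σ_k (k+1)²2^{−k}`): the divisors of `q²` are `1, q, q²` (all prime to `l`), `μ(q²) = 0`,
`κ̃₁(q²;d) = Σ_{k≥0} κ₁(q^{k+2})χ(qᵏ)q^{−k} = κ₁(q²) + O(1/q)` (`(q,d) = 1`, `|κ₁(qⁿ)| ≤ (n+1)²`),
`κ̃₁(q;dq) = κ₁(q) = q^{−β₁} + q^{−β₂} − 1` and `q/(q−1) = 1 + O(1/q)`. This is the second-order
companion of the manuscript's `ξ₁(q;d,l) = q^{−β₁} + q^{−β₂} − 1 − χ(q) + O(1/q)` (§15.u031).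
[cite: Zhang2022LandauSiegel, §15 (15.13) p. 83 and p. 84] -/
theorem norm_xi1_prime_sq_sub_le (c' : ℝ) {D : ℕ} (χ : DirichletCharacter ℂ D) {q d l : ℕ}
    (hq : q.Prime) (hcop : Nat.Coprime q (d * l)) :
    ‖xi1 c' χ (q ^ 2) d l -
        ((q : ℂ) ^ (-Skeleton.beta1 c' D) * (q : ℂ) ^ (-Skeleton.beta1 c' D) +
          (q : ℂ) ^ (-Skeleton.beta1 c' D) * (q : ℂ) ^ (-Skeleton.beta2 c' D) +
          (q : ℂ) ^ (-Skeleton.beta2 c' D) * (q : ℂ) ^ (-Skeleton.beta2 c' D) -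
          (q : ℂ) ^ (-Skeleton.beta1 c' D) - (q : ℂ) ^ (-Skeleton.beta2 c' D) -
          χ (q : ZMod D) *
            ((q : ℂ) ^ (-Skeleton.beta1 c' D) + (q : ℂ) ^ (-Skeleton.beta2 c' D) - 1))‖ ≤
      (16 * (∑' k : ℕ, ((k : ℝ) + 1) ^ 2 * (1 / 2 : ℝ) ^ k) + 6) / q := by
  classical
  set Z₂ : ℝ := ∑' k : ℕ, ((k : ℝ) + 1) ^ 2 * (1 / 2 : ℝ) ^ k with hZ₂
  set a : ℂ := (q : ℂ) ^ (-Skeleton.beta1 c' D) with ha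
  set b : ℂ := (q : ℂ) ^ (-Skeleton.beta2 c' D) with hb
  set v : ℂ := χ (q : ZMod D) with hvdef
  have hv : ‖v‖ ≤ 1 := DirichletCharacter.norm_le_one χ _
  have hq0 : (0 : ℝ) < q := by exact_mod_cast hq.pos
  have hq2 : (2 : ℝ) ≤ q := by exact_mod_cast hq.two_le
  have hqd : Nat.Coprime q d := Nat.Coprime.coprime_dvd_right (Dvd.intro l rfl) hcop
  have hql : Nat.Coprime q l := Nat.Coprime.coprime_dvd_right (Dvd.intro_left d rfl) hcop
  -- the `k`-series for `κ̃₁(q²; d, 1)`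
  set g : ℕ → ℂ := fun k => kappa1 c' D (q ^ 2 * q ^ k) * χ ((q ^ k : ℕ) : ZMod D) /
    ((q ^ k : ℕ) : ℂ) ^ (1 : ℂ) with hg
  have hκ2 : kappaTilde1 c' χ (q ^ 2) d 1 = ∑' k, g k := by
    unfold kappaTilde1
    rw [AppendixALocal.tsum_nset_prime_pow_of_coprime hq two_ne_zero hqd]
  have hκ1 : kappaTilde1 c' χ (q ^ 1) (d * q ^ 1) 1 = kappa1 c' D q := by
    unfold kappaTilde1
    rw [AppendixALocal.tsum_nset_prime_pow_of_dvd hq one_ne_zero (Dvd.intro_left d (by ring))]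
    simp
  -- the divisor sum
  have hfilt : (q ^ 2).divisors.filter (fun k => Nat.Coprime k l) = (q ^ 2).divisors := by
    rw [Finset.filter_true_of_mem]
    intro k hk
    exact Nat.Coprime.coprime_dvd_left (Nat.dvd_of_mem_divisors hk) (hql.pow_left 2)
  have hμ2 : (ArithmeticFunction.moebius (q ^ 2) : ℂ) = 0 := by
    rw [ArithmeticFunction.moebius_apply_prime_pow hq two_ne_zero]; simp
  have hxi : xi1 c' χ (q ^ 2) d l = (∑' k, g k) - v * (q : ℂ) / ((q : ℂ) - 1) * kappa1 c' D q := by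
    unfold xi1
    rw [hfilt, Nat.sum_divisors_prime_pow hq]
    simp only [Finset.sum_range_succ, Finset.sum_range_zero, zero_add, pow_zero, Nat.div_one,
      mul_one, Nat.cast_one, ArithmeticFunction.moebius_apply_one, Int.cast_one, Nat.totient_one,
      map_one, one_mul, div_one, hμ2, zero_mul, zero_div, add_zero]
    rw [hκ2, show q ^ 2 / q ^ 1 = q ^ 1 by rw [Nat.pow_div one_le_two hq.pos]; rfl, hκ1, pow_one,
      ArithmeticFunction.moebius_apply_prime hq, Nat.totient_prime hq, Nat.cast_sub hq.one_le]
    push_cast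
    ring
  -- summability and the tail of the `k`-series
  have hZ₂0 : 0 ≤ Z₂ := tsum_nonneg fun k => by positivity
  have hg_norm : ∀ k, ‖g k‖ ≤ ((k : ℝ) + 3) ^ 2 / (q : ℝ) ^ k := by
    intro k
    have hqk : (0 : ℝ) < (q : ℝ) ^ k := pow_pos hq0 k
    have hκ : ‖kappa1 c' D (q ^ 2 * q ^ k)‖ ≤ ((k : ℝ) + 3) ^ 2 := by
      rw [← pow_add]
      have := MeanSquareMajorant.norm_kappa₁_prime_pow_le (Skeleton.b1 c' D) (Skeleton.b2 c' D)
        hq (2 + k)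
      unfold kappa1
      calc ‖MeanSquareMajorant.kappa₁ (Skeleton.b1 c' D) (Skeleton.b2 c' D) (q ^ (2 + k))‖
          ≤ (((2 + k : ℕ) : ℝ) + 1) ^ 2 := this
        _ = ((k : ℝ) + 3) ^ 2 := by push_cast; ring
    have hχ : ‖χ ((q ^ k : ℕ) : ZMod D)‖ ≤ 1 := DirichletCharacter.norm_le_one χ _
    have hden : ‖((q ^ k : ℕ) : ℂ) ^ (1 : ℂ)‖ = (q : ℝ) ^ k := by
      rw [cpow_one, Complex.norm_natCast, Nat.cast_pow]
    simp only [hg]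
    rw [norm_div, norm_mul, hden, div_le_div_iff_of_pos_right hqk]
    calc ‖kappa1 c' D (q ^ 2 * q ^ k)‖ * ‖χ ((q ^ k : ℕ) : ZMod D)‖ ≤ ((k : ℝ) + 3) ^ 2 * 1 := by
          gcongr
      _ = ((k : ℝ) + 3) ^ 2 := mul_one _
  have hmaj : ∀ k, ‖g k‖ ≤ 9 * (((k : ℝ) + 1) ^ 2 * (1 / 2 : ℝ) ^ k) := by
    intro k
    refine (hg_norm k).trans ?_
    have h1 : ((q : ℝ) ^ k)⁻¹ ≤ (1 / 2 : ℝ) ^ k := by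
      rw [← inv_pow, one_div]
      exact pow_le_pow_left₀ (by positivity) (inv_anti₀ (by norm_num) hq2) k
    have h2 : ((k : ℝ) + 3) ^ 2 ≤ 9 * ((k : ℝ) + 1) ^ 2 := by
      have hk : (0 : ℝ) ≤ k := Nat.cast_nonneg k
      nlinarith
    rw [div_eq_mul_inv]
    calc ((k : ℝ) + 3) ^ 2 * ((q : ℝ) ^ k)⁻¹ ≤ (9 * ((k : ℝ) + 1) ^ 2) * (1 / 2 : ℝ) ^ k :=
          mul_le_mul h2 h1 (by positivity) (by positivity)
      _ = 9 * (((k : ℝ) + 1) ^ 2 * (1 / 2 : ℝ) ^ k) := by ring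
  have hgs : Summable g := Summable.of_norm_bounded (summable_sq_geom'.mul_left 9) hmaj
  have hsplit : ∑' k, g k = g 0 + ∑' k, g (k + 1) := hgs.tsum_eq_zero_add
  have hg0 : g 0 = a * a + a * b + b * b - a - b := by
    simp only [hg, pow_zero, mul_one, Nat.cast_one, map_one, cpow_one, div_one]
    rw [kappa1_prime_sq c' hq]
  have htail_norm : ∀ k, ‖g (k + 1)‖ ≤ (1 / (q : ℝ)) * (16 * (((k : ℝ) + 1) ^ 2 * (1 / 2 : ℝ) ^ k)) := by
    intro k
    refine (hg_norm (k + 1)).trans ?_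
    have hqne : (q : ℝ) ≠ 0 := hq0.ne'
    have e : ((((k + 1 : ℕ) : ℝ)) + 3) ^ 2 / (q : ℝ) ^ (k + 1) =
        (1 / (q : ℝ)) * (((k : ℝ) + 4) ^ 2 * ((q : ℝ) ^ k)⁻¹) := by
      push_cast
      field_simp
      ring
    have h1 : ((q : ℝ) ^ k)⁻¹ ≤ (1 / 2 : ℝ) ^ k := by
      rw [← inv_pow, one_div]
      exact pow_le_pow_left₀ (by positivity) (inv_anti₀ (by norm_num) hq2) k
    have h2 : ((k : ℝ) + 4) ^ 2 ≤ 16 * ((k : ℝ) + 1) ^ 2 := by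
      have hk : (0 : ℝ) ≤ k := Nat.cast_nonneg k
      nlinarith
    rw [e]
    gcongr (1 / (q : ℝ)) * ?_
    calc ((k : ℝ) + 4) ^ 2 * ((q : ℝ) ^ k)⁻¹ ≤ (16 * ((k : ℝ) + 1) ^ 2) * (1 / 2 : ℝ) ^ k :=
          mul_le_mul h2 h1 (by positivity) (by positivity)
      _ = 16 * (((k : ℝ) + 1) ^ 2 * (1 / 2 : ℝ) ^ k) := by ring
  have htail_s : Summable (fun k => g (k + 1)) := (summable_nat_add_iff 1).mpr hgs
  have htail : ‖∑' k, g (k + 1)‖ ≤ (1 / (q : ℝ)) * (16 * Z₂) := by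
    calc ‖∑' k, g (k + 1)‖ ≤ ∑' k, ‖g (k + 1)‖ := norm_tsum_le_tsum_norm htail_s.norm
      _ ≤ ∑' k : ℕ, (1 / (q : ℝ)) * (16 * (((k : ℝ) + 1) ^ 2 * (1 / 2 : ℝ) ^ k)) :=
          hasSum_le htail_norm htail_s.norm.hasSum
            (((summable_sq_geom'.mul_left 16)).mul_left _).hasSum
      _ = (1 / (q : ℝ)) * (16 * Z₂) := by rw [tsum_mul_left, tsum_mul_left]
  -- the `χ(q)q/(q−1)·κ₁(q)` term
  have hq1c : ((q : ℂ) - 1) ≠ 0 := by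
    rw [← norm_pos_iff, norm_natCast_sub_one hq.one_le]; linarith
  have hκq : kappa1 c' D q = a + b - 1 := kappa1_prime c' hq
  have hκqn : ‖kappa1 c' D q‖ ≤ 3 := by
    rw [hκq]
    calc ‖a + b - 1‖ ≤ ‖a + b‖ + ‖(1 : ℂ)‖ := norm_sub_le _ _
      _ ≤ ‖a‖ + ‖b‖ + 1 := by rw [norm_one]; gcongr; exact norm_add_le _ _
      _ = 3 := by rw [ha, hb, norm_cpow_neg_beta1 c' D hq.pos, norm_cpow_neg_beta2 c' D hq.pos]; norm_num
  have hcorr : ‖v * kappa1 c' D q / ((q : ℂ) - 1)‖ ≤ 6 / q := by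
    rw [norm_div, norm_mul, norm_natCast_sub_one hq.one_le]
    have hpos : (0 : ℝ) < (q : ℝ) - 1 := by linarith
    rw [div_le_div_iff₀ hpos hq0]
    calc ‖v‖ * ‖kappa1 c' D q‖ * q ≤ 1 * 3 * q := by gcongr
      _ ≤ 6 * ((q : ℝ) - 1) := by linarith
  -- assemble
  rw [hxi]
  have key : (∑' k, g k) - v * (q : ℂ) / ((q : ℂ) - 1) * kappa1 c' D q -
      (a * a + a * b + b * b - a - b - v * (a + b - 1)) =
      (∑' k, g (k + 1)) - v * kappa1 c' D q / ((q : ℂ) - 1) := by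
    rw [hsplit, hg0, hκq]
    field_simp
    ring
  rw [key]
  calc ‖(∑' k, g (k + 1)) - v * kappa1 c' D q / ((q : ℂ) - 1)‖
      ≤ ‖∑' k, g (k + 1)‖ + ‖v * kappa1 c' D q / ((q : ℂ) - 1)‖ := norm_sub_le _ _
    _ ≤ (1 / (q : ℝ)) * (16 * Z₂) + 6 / q := add_le_add htail hcorr
    _ = (16 * Z₂ + 6) / q := by rw [one_div_mul_eq_div, ← add_div]

/-! ## `Σ_{r≥1} ξ₁(qʳ;d,l)q^{−rs} = ξ₁(q)x + ξ₁(q²)x² + O(|x|³)`, `x = q^{−s}` -/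

/-- `Σ_k (k+1)³ (3/4)^k` converges. [folklore] -/
private theorem summable_cube_geom : Summable (fun k : ℕ => ((k : ℝ) + 1) ^ 3 * (3 / 4 : ℝ) ^ k) := by
  have h : Summable (fun n : ℕ => (n : ℝ) ^ 3 * (3 / 4 : ℝ) ^ n) :=
    summable_pow_mul_geometric_of_norm_lt_one 3 (by rw [Real.norm_eq_abs]; norm_num)
  have h2 : Summable (fun n : ℕ => (((n + 1 : ℕ) : ℝ)) ^ 3 * (3 / 4 : ℝ) ^ (n + 1)) :=
    (summable_nat_add_iff 1).mpr h
  refine (h2.mul_left (4 / 3)).congr fun n => ?_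
  push_cast
  rw [pow_succ]
  ring

/-- `2^{−9/10} ≤ 3/4` (indeed `(4/3)^{10} ≤ 2^9`). [folklore] -/
private theorem two_rpow_neg_nine_tenths_le : (2 : ℝ) ^ (-(9 / 10 : ℝ)) ≤ 3 / 4 := by
  have hpow : ((2 : ℝ) ^ (9 / 10 : ℝ)) ^ (10 : ℕ) = 2 ^ (9 : ℕ) := by
    rw [← Real.rpow_mul_natCast (by norm_num : (0 : ℝ) ≤ 2)]; norm_num
  have hpos : 0 < (2 : ℝ) ^ (9 / 10 : ℝ) := Real.rpow_pos_of_pos (by norm_num) _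
  have h43 : 4 / 3 ≤ (2 : ℝ) ^ (9 / 10 : ℝ) := by
    by_contra h
    rw [not_le] at h
    have : ((2 : ℝ) ^ (9 / 10 : ℝ)) ^ (10 : ℕ) < (4 / 3 : ℝ) ^ (10 : ℕ) :=
      pow_lt_pow_left₀ h hpos.le (by norm_num)
    rw [hpow] at this
    norm_num at this
  rw [Real.rpow_neg (by norm_num : (0 : ℝ) ≤ 2)]
  calc ((2 : ℝ) ^ (9 / 10 : ℝ))⁻¹ ≤ (4 / 3 : ℝ)⁻¹ := inv_anti₀ (by norm_num) h43
    _ = 3 / 4 := by norm_num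

/-- For `q ≥ 2` and `σ > 9/10`: `q^{−σ} ≤ 3/4`. [folklore] -/
private theorem rpow_neg_le_three_quarters' {q : ℕ} (hq : 2 ≤ q) {σ : ℝ} (hσ : 9 / 10 < σ) :
    (q : ℝ) ^ (-σ) ≤ 3 / 4 := by
  have hq1 : (1 : ℝ) ≤ q := by exact_mod_cast (le_trans (by norm_num) hq)
  have hq2 : (2 : ℝ) ≤ q := by exact_mod_cast hq
  calc (q : ℝ) ^ (-σ) ≤ (q : ℝ) ^ (-(9 / 10 : ℝ)) :=
        Real.rpow_le_rpow_of_exponent_le hq1 (by linarith)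
    _ ≤ (2 : ℝ) ^ (-(9 / 10 : ℝ)) :=
        Real.rpow_le_rpow_of_nonpos (by norm_num) hq2 (by norm_num)
    _ ≤ 3 / 4 := two_rpow_neg_nine_tenths_le

/-- **`Σ_{r≥1} ξ₁(qʳ;d,l)q^{−rs} = ξ₁(q;d,l)x + ξ₁(q²;d,l)x² + Σ_{k≥0} ξ₁(q^{k+3};d,l)x^{k+3}`** with
`x = q^{−s}`, for `σ > 9/10` (all three series converge absolutely: `|ξ₁(qʳ)| ≤ 4Z₂(r+1)³`,
`|x| ≤ 3/4`), together with the tail bound **`|Σ_{k≥0} ξ₁(q^{k+3})x^{k+3}| ≤ 256Z₂Z₃·q^{−3σ}`**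
(`Z₃ = Σ_k (k+1)³(3/4)ᵏ`). [cite: Zhang2022LandauSiegel, §15 p. 84] -/
theorem xi1LocalSeries_eq_split3 (c' : ℝ) {D : ℕ} (χ : DirichletCharacter ℂ D) {q : ℕ}
    (hq : q.Prime) (d l : ℕ) {s : ℂ} (hs : 9 / 10 < s.re) :
    (Summable fun k : ℕ => xi1 c' χ (q ^ (k + 3)) d l * ((q : ℂ) ^ (-s)) ^ (k + 3)) ∧
    xi1LocalSeries c' χ q d l s =
      xi1 c' χ q d l * (q : ℂ) ^ (-s) + xi1 c' χ (q ^ 2) d l * ((q : ℂ) ^ (-s)) ^ 2 +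
        ∑' k : ℕ, xi1 c' χ (q ^ (k + 3)) d l * ((q : ℂ) ^ (-s)) ^ (k + 3) ∧
    ‖∑' k : ℕ, xi1 c' χ (q ^ (k + 3)) d l * ((q : ℂ) ^ (-s)) ^ (k + 3)‖ ≤
      256 * (∑' k : ℕ, ((k : ℝ) + 1) ^ 2 * (1 / 2 : ℝ) ^ k) *
        (∑' k : ℕ, ((k : ℝ) + 1) ^ 3 * (3 / 4 : ℝ) ^ k) * ((q : ℝ) ^ (-s.re)) ^ 3 := by
  classical
  set Z₂ : ℝ := ∑' k : ℕ, ((k : ℝ) + 1) ^ 2 * (1 / 2 : ℝ) ^ k with hZ₂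
  set Z₃ : ℝ := ∑' k : ℕ, ((k : ℝ) + 1) ^ 3 * (3 / 4 : ℝ) ^ k with hZ₃
  have hZ₂0 : 0 ≤ Z₂ := tsum_nonneg fun k => by positivity
  have hq0 : (0 : ℝ) < q := by exact_mod_cast hq.pos
  have hqC : (q : ℂ) ≠ 0 := by exact_mod_cast hq.ne_zero
  set σ : ℝ := s.re with hσ
  set w : ℝ := (q : ℝ) ^ (-σ) with hw
  set x : ℂ := (q : ℂ) ^ (-s) with hx
  have hw0 : 0 < w := Real.rpow_pos_of_pos hq0 _
  have hw34 : w ≤ 3 / 4 := rpow_neg_le_three_quarters' hq.two_le hs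
  have hxn : ‖x‖ = w := by rw [hx, Complex.norm_natCast_cpow_of_pos hq.pos, neg_re]
  -- the terms `T r = ξ₁(qʳ) xʳ`
  set T : ℕ → ℂ := fun r => xi1 c' χ (q ^ r) d l * x ^ r with hT
  have hT_le : ∀ r, ‖T r‖ ≤ 4 * Z₂ * ((r : ℝ) + 1) ^ 3 * w ^ r := fun r => by
    rw [hT, norm_mul, norm_pow, hxn]
    exact mul_le_mul_of_nonneg_right (norm_xi1_prime_pow_le c' χ hq d l r) (pow_nonneg hw0.le r)
  -- the tail
  have htail_le : ∀ k, ‖T (k + 3)‖ ≤ 256 * Z₂ * w ^ 3 * (((k : ℝ) + 1) ^ 3 * (3 / 4 : ℝ) ^ k) := by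
    intro k
    refine (hT_le (k + 3)).trans ?_
    have h1 : w ^ (k + 3) ≤ w ^ 3 * (3 / 4 : ℝ) ^ k := by
      rw [pow_add, mul_comm]
      exact mul_le_mul_of_nonneg_left (pow_le_pow_left₀ hw0.le hw34 k) (pow_nonneg hw0.le 3)
    have h2 : (((k + 3 : ℕ) : ℝ) + 1) ^ 3 ≤ 64 * ((k : ℝ) + 1) ^ 3 := by
      push_cast
      have hk : (0 : ℝ) ≤ k := Nat.cast_nonneg k
      nlinarith [pow_nonneg hk 2, pow_nonneg hk 3]
    calc 4 * Z₂ * (((k + 3 : ℕ) : ℝ) + 1) ^ 3 * w ^ (k + 3)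
        ≤ 4 * Z₂ * (64 * ((k : ℝ) + 1) ^ 3) * (w ^ 3 * (3 / 4 : ℝ) ^ k) := by gcongr
      _ = 256 * Z₂ * w ^ 3 * (((k : ℝ) + 1) ^ 3 * (3 / 4 : ℝ) ^ k) := by ring
  have htail_s : Summable fun k => T (k + 3) :=
    Summable.of_norm_bounded (summable_cube_geom.mul_left _) htail_le
  have htail : ‖∑' k, T (k + 3)‖ ≤ 256 * Z₂ * Z₃ * w ^ 3 := by
    calc ‖∑' k, T (k + 3)‖ ≤ ∑' k, ‖T (k + 3)‖ := norm_tsum_le_tsum_norm htail_s.norm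
      _ ≤ ∑' k : ℕ, 256 * Z₂ * w ^ 3 * (((k : ℝ) + 1) ^ 3 * (3 / 4 : ℝ) ^ k) :=
          hasSum_le htail_le htail_s.norm.hasSum (summable_cube_geom.mul_left _).hasSum
      _ = 256 * Z₂ * Z₃ * w ^ 3 := by rw [tsum_mul_left, hZ₃]; ring
  -- the full series
  have hTs : Summable T := by
    have h3 : Summable fun k => T (k + 3) := htail_s
    exact (summable_nat_add_iff 3).mp h3
  have hterm : ∀ r : ℕ, (if r = 0 then (0 : ℂ) else xi1 c' χ (q ^ r) d l / (q : ℂ) ^ ((r : ℂ) * s)) =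
      if r = 0 then 0 else T r := by
    intro r
    split_ifs
    · rfl
    · rw [hT, Complex.cpow_nat_mul, div_eq_mul_inv, ← inv_pow, hx, Complex.cpow_neg]
  have hF_s : Summable fun r : ℕ => if r = 0 then (0 : ℂ) else T r := by
    refine hTs.norm.of_norm_bounded fun r => ?_
    split_ifs
    · rw [norm_zero]; exact norm_nonneg _
    · exact le_rfl
  have hseries : xi1LocalSeries c' χ q d l s = ∑' r : ℕ, if r = 0 then (0 : ℂ) else T r := by
    unfold xi1LocalSeries
    exact tsum_congr hterm
  refine ⟨htail_s, ?_, htail⟩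
  rw [hseries, ← hF_s.sum_add_tsum_nat_add 3]
  have hhead : (∑ i ∈ Finset.range 3, (if i = 0 then (0 : ℂ) else T i)) = T 1 + T 2 := by
    simp [Finset.sum_range_succ]
  have h3 : (∑' k : ℕ, (if k + 3 = 0 then (0 : ℂ) else T (k + 3))) = ∑' k : ℕ, T (k + 3) :=
    tsum_congr fun k => if_neg (by omega)
  rw [hhead, h3]
  simp only [hT, pow_one]

/-! ## `§15.u032` -/

/-- `1 − θ ≤ ‖1 − vw‖` for `‖v‖ ≤ 1`, `‖w‖ ≤ θ`. [folklore] -/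
private theorem one_sub_le_norm_one_sub_mul {v w : ℂ} {θ : ℝ} (hv : ‖v‖ ≤ 1) (hw : ‖w‖ ≤ θ) :
    1 - θ ≤ ‖1 - v * w‖ := by
  have hvw : ‖v * w‖ ≤ θ := by
    rw [norm_mul]
    calc ‖v‖ * ‖w‖ ≤ 1 * θ := mul_le_mul hv hw (norm_nonneg _) zero_le_one
      _ = θ := one_mul _
  have := norm_sub_norm_le (1 : ℂ) (v * w)
  rw [norm_one] at this
  linarith

/-- **§15.u032 holds** (DAG `Z22:§15.u032`, [Z22 p.84, tex L4195–L4201]): for a prime `q` with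
`(q,dl) = 1` and `σ > 9/10`,
`‖(1−q^{−s−β₁})(1−q^{−s−β₂})(1−q^{−s})⁻¹(1−χ(q)q^{−s})⁻¹(1 + λ̃₁(q,d)Σ_rξ₁(qʳ;d,l)q^{−rs}) − 1‖ ≤ C·q^{−19/10}`
with an absolute constant `C` (for all `D`, all `χ`; hypothesis (A) is not used). Writing `x = q^{−s}`,
`a = q^{−β₁}`, `b = q^{−β₂}`, `v = χ(q)`, `N = (1−ax)(1−bx)`, `Δ = (1−x)(1−vx)`, `λ̃₁ = 1 + μ`,
`Σ_r ξ₁(qʳ)xʳ = E₁x + E₂x² + R₃`, `E₁ = a + b − 1 − v + e₁`, `E₂ = a² + ab + b² − a − b − v(a+b−1) + e₂`: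
`N(1 + λ̃₁Σ) − Δ = e₁x + (e₂ − (a+b)e₁)x² + (abE₁ − (a+b)E₂)x³ + abE₂x⁴ + NR₃ + NμΣ` EXACTLY (the
`O(1)` parts of the `x`- and `x²`-coefficients cancel), and each term is `O(q^{−1−σ})` or `O(q^{−3σ})`,
both `≤ q^{−19/10}`; `|Δ| ≥ 1/16`. Inputs: `step15_u031_holds` (`e₁ = O(1/q)`),
`norm_xi1_prime_sq_sub_le` (`e₂ = O(1/q)`), `norm_lamTilde1_prime_sub_one_le` (`μ = O(1/q)`),
`xi1LocalSeries_eq_split3` (`R₃ = O(q^{−3σ})`), `norm_xi1LocalSeries_le`, `norm_xi1_prime_pow_le`.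
[cite: Zhang2022LandauSiegel, §15 p. 84] -/
theorem step15_u032_holds (c' : ℝ) : Step15_u032 c' := by
  classical
  obtain ⟨C₁, D₁, h31⟩ := step15_u031_holds c'
  -- the absolute constants
  set Z₂ : ℝ := ∑' k : ℕ, ((k : ℝ) + 1) ^ 2 * (1 / 2 : ℝ) ^ k with hZ₂
  set Z₃ : ℝ := ∑' k : ℕ, ((k : ℝ) + 1) ^ 3 * (3 / 4 : ℝ) ^ k with hZ₃
  have hZ₂0 : 0 ≤ Z₂ := tsum_nonneg fun k => by positivity
  have hZ₃0 : 0 ≤ Z₃ := tsum_nonneg fun k => by positivity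
  set K : ℝ := (16 / 3) * Z₂ * Z₃ with hK
  have hK0 : 0 ≤ K := by rw [hK]; positivity
  set C₁' : ℝ := max C₁ 0 with hC₁'
  have hC₁'0 : 0 ≤ C₁' := le_max_right _ _
  set C₂ : ℝ := 16 * Z₂ + 6 with hC₂
  have hC₂0 : 0 ≤ C₂ := by rw [hC₂]; positivity
  set C₃ : ℝ := 256 * Z₂ * Z₃ with hC₃
  have hC₃0 : 0 ≤ C₃ := by rw [hC₃]; positivity
  set A₁ : ℝ := 3 * C₁' + C₂ + 32 * K with hA₁
  set A₃ : ℝ := 356 * Z₂ + 4 * C₃ with hA₃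
  have hA₁0 : 0 ≤ A₁ := by rw [hA₁]; positivity
  have hA₃0 : 0 ≤ A₃ := by rw [hA₃]; positivity
  refine ⟨16 * (A₁ + A₃), D₁, fun D _ χ hD hquad hprim hA q d l hq hd hl hcop s hs => ?_⟩
  -- the first-order input `§15.u031`
  have he₁' := (h31 D χ hD hquad hprim hA q d l hq hd hl hcop).2
  -- notation
  have hq0 : (0 : ℝ) < q := by exact_mod_cast hq.pos
  have hq1 : (1 : ℝ) ≤ q := by exact_mod_cast hq.one_lt.le
  have hq2 : (2 : ℝ) ≤ q := by exact_mod_cast hq.two_le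
  have hqC : (q : ℂ) ≠ 0 := by exact_mod_cast hq.ne_zero
  set σ : ℝ := s.re with hσ
  set w : ℝ := (q : ℝ) ^ (-σ) with hw
  have hw0 : 0 < w := Real.rpow_pos_of_pos hq0 _
  have hw34 : w ≤ 3 / 4 := rpow_neg_le_three_quarters' hq.two_le hs
  have hw1 : w ≤ 1 := by linarith
  set x : ℂ := (q : ℂ) ^ (-s) with hx
  set a : ℂ := (q : ℂ) ^ (-Skeleton.beta1 c' D) with ha
  set b : ℂ := (q : ℂ) ^ (-Skeleton.beta2 c' D) with hb
  set v : ℂ := χ (q : ZMod D) with hvdef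
  have hxn : ‖x‖ = w := by rw [hx, Complex.norm_natCast_cpow_of_pos hq.pos, neg_re]
  have han : ‖a‖ = 1 := norm_cpow_neg_beta1 c' D hq.pos
  have hbn : ‖b‖ = 1 := norm_cpow_neg_beta2 c' D hq.pos
  have hv : ‖v‖ ≤ 1 := DirichletCharacter.norm_le_one χ _
  have hax : (q : ℂ) ^ (-(s + Skeleton.beta1 c' D)) = x * a := by
    rw [neg_add, Complex.cpow_add _ _ hqC]
  have hbx : (q : ℂ) ^ (-(s + Skeleton.beta2 c' D)) = x * b := by
    rw [neg_add, Complex.cpow_add _ _ hqC]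
  -- the pieces of the second factor
  set lam : ℂ := lamTilde1 c' χ q d with hlam
  set μ : ℂ := lam - 1 with hμ
  have hμn : ‖μ‖ ≤ 8 / q := norm_lamTilde1_prime_sub_one_le c' χ hq d
  set X : ℂ := xi1LocalSeries c' χ q d l s with hXdef
  have hXn : ‖X‖ ≤ K * w := by
    have := norm_xi1LocalSeries_le c' χ hq d l hs
    rw [hXdef, hK]; exact this
  obtain ⟨-, hsplit, hR₃n⟩ := xi1LocalSeries_eq_split3 c' χ hq d l hs
  set R₃ : ℂ := ∑' k : ℕ, xi1 c' χ (q ^ (k + 3)) d l * x ^ (k + 3) with hR₃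
  set E₁ : ℂ := xi1 c' χ q d l with hE₁
  set E₂ : ℂ := xi1 c' χ (q ^ 2) d l with hE₂
  have hX : X = E₁ * x + E₂ * x ^ 2 + R₃ := hsplit
  have hE₁n : ‖E₁‖ ≤ 32 * Z₂ := by
    have := norm_xi1_prime_pow_le c' χ hq d l 1
    rw [pow_one] at this
    refine this.trans ?_
    norm_num [hZ₂.symm]
    nlinarith
  have hE₂n : ‖E₂‖ ≤ 108 * Z₂ := by
    have := norm_xi1_prime_pow_le c' χ hq d l 2
    refine this.trans ?_
    norm_num [hZ₂.symm]
    nlinarith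
  set e₁ : ℂ := E₁ - (a + b - 1 - v) with he₁
  set e₂ : ℂ := E₂ - (a * a + a * b + b * b - a - b - v * (a + b - 1)) with he₂
  have he₁n : ‖e₁‖ ≤ C₁' / q := by
    refine he₁'.trans ?_
    gcongr
    exact le_max_left _ _
  have he₂n : ‖e₂‖ ≤ C₂ / q := norm_xi1_prime_sq_sub_le c' χ hq hcop
  have hR₃w : ‖R₃‖ ≤ C₃ * w ^ 3 := by rw [hR₃, hC₃]; exact hR₃n
  -- the prefactor's numerator and denominator
  set N : ℂ := (1 - x * a) * (1 - x * b) with hN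
  set Δ : ℂ := (1 - x) * (1 - v * x) with hΔ
  have hNn : ‖N‖ ≤ 4 := by
    rw [hN, norm_mul]
    have h1 : ‖1 - x * a‖ ≤ 2 := by
      calc ‖1 - x * a‖ ≤ ‖(1 : ℂ)‖ + ‖x * a‖ := norm_sub_le _ _
        _ = 1 + w := by rw [norm_one, norm_mul, hxn, han, mul_one]
        _ ≤ 2 := by linarith
    have h2 : ‖1 - x * b‖ ≤ 2 := by
      calc ‖1 - x * b‖ ≤ ‖(1 : ℂ)‖ + ‖x * b‖ := norm_sub_le _ _
        _ = 1 + w := by rw [norm_one, norm_mul, hxn, hbn, mul_one]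
        _ ≤ 2 := by linarith
    calc ‖1 - x * a‖ * ‖1 - x * b‖ ≤ 2 * 2 :=
          mul_le_mul h1 h2 (norm_nonneg _) (by norm_num)
      _ = 4 := by norm_num
  have hΔn : 1 / 16 ≤ ‖Δ‖ := by
    rw [hΔ, norm_mul]
    have h1 : 1 - w ≤ ‖1 - 1 * x‖ := one_sub_le_norm_one_sub_mul (by simp) hxn.le
    rw [one_mul] at h1
    have h2 : 1 - w ≤ ‖1 - v * x‖ := one_sub_le_norm_one_sub_mul hv hxn.le
    have h14 : (1 : ℝ) / 4 ≤ 1 - w := by linarith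
    calc (1 : ℝ) / 16 = 1 / 4 * (1 / 4) := by norm_num
      _ ≤ ‖1 - x‖ * ‖1 - v * x‖ :=
          mul_le_mul (h14.trans h1) (h14.trans h2) (by norm_num) (norm_nonneg _)
  have hΔ0 : Δ ≠ 0 := by
    intro h; rw [h, norm_zero] at hΔn; linarith
  -- the factor and the exact identity
  have hfac : calM1Factor c' χ q d l s = N / Δ * (1 + lam * X) := by
    show (1 - (q : ℂ) ^ (-(s + Skeleton.beta1 c' D))) * (1 - (q : ℂ) ^ (-(s + Skeleton.beta2 c' D))) /
        ((1 - x) * (1 - v * x)) * (1 + lam * X) = N / Δ * (1 + lam * X)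
    rw [hax, hbx]
  have hsub : calM1Factor c' χ q d l s - 1 = (N * (1 + lam * X) - Δ) / Δ := by
    rw [hfac, div_mul_eq_mul_div, div_sub_one hΔ0]
  have hident : N * (1 + lam * X) - Δ =
      e₁ * x + (e₂ - (a + b) * e₁) * x ^ 2 +
        ((a * b * E₁ - (a + b) * E₂) * x ^ 3 + a * b * E₂ * x ^ 4 + N * R₃ + N * μ * X) := by
    have hl : lam = 1 + μ := by rw [hμ]; ring
    have hE₁e : E₁ = (a + b - 1 - v) + e₁ := by rw [he₁]; ring
    have hE₂e : E₂ = (a * a + a * b + b * b - a - b - v * (a + b - 1)) + e₂ := by rw [he₂]; ring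
    rw [hl, hN, hΔ]
    conv_lhs => rw [hX, hE₁e, hE₂e]
    conv_rhs => rw [hX]
    rw [hE₁e, hE₂e]
    ring
  -- the six bounds
  have hwq : 0 ≤ w / q := by positivity
  have t1 : ‖e₁ * x‖ ≤ C₁' * (w / q) := by
    rw [norm_mul, hxn]
    calc ‖e₁‖ * w ≤ C₁' / q * w := by gcongr
      _ = C₁' * (w / q) := by ring
  have t2 : ‖(e₂ - (a + b) * e₁) * x ^ 2‖ ≤ (C₂ + 2 * C₁') * (w / q) := by
    rw [norm_mul, norm_pow, hxn]
    have hab : ‖a + b‖ ≤ 2 := (norm_add_le _ _).trans (by rw [han, hbn]; norm_num)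
    have h1 : ‖e₂ - (a + b) * e₁‖ ≤ C₂ / q + 2 * (C₁' / q) := by
      refine norm_sub_le_of_le he₂n ?_
      rw [norm_mul]
      exact mul_le_mul hab he₁n (norm_nonneg _) (by norm_num)
    have h2 : w ^ 2 ≤ w := by rw [sq]; exact mul_le_of_le_one_right hw0.le hw1
    have h3 : 0 ≤ C₂ / q + 2 * (C₁' / q) :=
      add_nonneg (div_nonneg hC₂0 hq0.le) (mul_nonneg zero_le_two (div_nonneg hC₁'0 hq0.le))
    calc ‖e₂ - (a + b) * e₁‖ * w ^ 2 ≤ (C₂ / q + 2 * (C₁' / q)) * w :=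
          mul_le_mul h1 h2 (pow_nonneg hw0.le 2) h3
      _ = (C₂ + 2 * C₁') * (w / q) := by ring
  have t3 : ‖(a * b * E₁ - (a + b) * E₂) * x ^ 3‖ ≤ 248 * Z₂ * w ^ 3 := by
    rw [norm_mul, norm_pow, hxn]
    have hab : ‖a + b‖ ≤ 2 := (norm_add_le _ _).trans (by rw [han, hbn]; norm_num)
    have h1 : ‖a * b * E₁ - (a + b) * E₂‖ ≤ 32 * Z₂ + 2 * (108 * Z₂) := by
      refine norm_sub_le_of_le ?_ ?_
      · rw [norm_mul, norm_mul, han, hbn, one_mul, one_mul]; exact hE₁n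
      · rw [norm_mul]
        exact mul_le_mul hab hE₂n (norm_nonneg _) (by norm_num)
    calc ‖a * b * E₁ - (a + b) * E₂‖ * w ^ 3 ≤ (32 * Z₂ + 2 * (108 * Z₂)) * w ^ 3 :=
          mul_le_mul_of_nonneg_right h1 (pow_nonneg hw0.le 3)
      _ = 248 * Z₂ * w ^ 3 := by ring
  have t4 : ‖a * b * E₂ * x ^ 4‖ ≤ 108 * Z₂ * w ^ 3 := by
    rw [norm_mul, norm_pow, hxn, norm_mul, norm_mul, han, hbn, one_mul, one_mul]
    have h2 : w ^ 4 ≤ w ^ 3 := by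
      rw [pow_succ]
      exact mul_le_of_le_one_right (pow_nonneg hw0.le 3) hw1
    exact mul_le_mul hE₂n h2 (by positivity) (by positivity)
  have t5 : ‖N * R₃‖ ≤ 4 * C₃ * w ^ 3 := by
    rw [norm_mul]
    calc ‖N‖ * ‖R₃‖ ≤ 4 * (C₃ * w ^ 3) := mul_le_mul hNn hR₃w (norm_nonneg _) (by norm_num)
      _ = 4 * C₃ * w ^ 3 := by ring
  have t6 : ‖N * μ * X‖ ≤ 32 * K * (w / q) := by
    rw [norm_mul, norm_mul]
    calc ‖N‖ * ‖μ‖ * ‖X‖ ≤ 4 * (8 / q) * (K * w) :=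
          mul_le_mul (mul_le_mul hNn hμn (norm_nonneg _) (by norm_num)) hXn (norm_nonneg _)
            (by positivity)
      _ = 32 * K * (w / q) := by ring
  have hnum : ‖N * (1 + lam * X) - Δ‖ ≤ A₁ * (w / q) + A₃ * w ^ 3 := by
    rw [hident]
    calc ‖e₁ * x + (e₂ - (a + b) * e₁) * x ^ 2 +
          ((a * b * E₁ - (a + b) * E₂) * x ^ 3 + a * b * E₂ * x ^ 4 + N * R₃ + N * μ * X)‖
        ≤ C₁' * (w / q) + (C₂ + 2 * C₁') * (w / q) +
          (248 * Z₂ * w ^ 3 + 108 * Z₂ * w ^ 3 + 4 * C₃ * w ^ 3 + 32 * K * (w / q)) :=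
          norm_add_le_of_le (norm_add_le_of_le t1 t2)
            (norm_add_le_of_le (norm_add_le_of_le (norm_add_le_of_le t3 t4) t5) t6)
      _ = A₁ * (w / q) + A₃ * w ^ 3 := by rw [hA₁, hA₃]; ring
  -- `w/q ≤ q^{−19/10}` and `w³ ≤ q^{−19/10}`
  have hwq' : w / q ≤ (q : ℝ) ^ (-(19 / 10 : ℝ)) := by
    have e : w / q = (q : ℝ) ^ (-σ + (-1 : ℝ)) := by
      rw [Real.rpow_add hq0, Real.rpow_neg_one, hw, div_eq_mul_inv]
    rw [e]
    exact Real.rpow_le_rpow_of_exponent_le hq1 (by linarith)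
  have hw3' : w ^ 3 ≤ (q : ℝ) ^ (-(19 / 10 : ℝ)) := by
    have e : w ^ 3 = (q : ℝ) ^ (-σ * (3 : ℕ)) := by
      rw [hw, Real.rpow_mul_natCast hq0.le]
    rw [e]
    exact Real.rpow_le_rpow_of_exponent_le hq1 (by push_cast; linarith)
  -- assemble
  rw [hsub, norm_div]
  have hΔpos : 0 < ‖Δ‖ := by linarith
  rw [div_le_iff₀ hΔpos]
  calc ‖N * (1 + lam * X) - Δ‖ ≤ A₁ * (w / q) + A₃ * w ^ 3 := hnum
    _ ≤ A₁ * (q : ℝ) ^ (-(19 / 10 : ℝ)) + A₃ * (q : ℝ) ^ (-(19 / 10 : ℝ)) :=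
        add_le_add (mul_le_mul_of_nonneg_left hwq' hA₁0) (mul_le_mul_of_nonneg_left hw3' hA₃0)
    _ = 16 * (A₁ + A₃) * (q : ℝ) ^ (-(19 / 10 : ℝ)) * (1 / 16) := by ring
    _ ≤ 16 * (A₁ + A₃) * (q : ℝ) ^ (-(19 / 10 : ℝ)) * ‖Δ‖ :=
        mul_le_mul_of_nonneg_left hΔn
          (mul_nonneg (mul_nonneg (by norm_num) (add_nonneg hA₁0 hA₃0)) (Real.rpow_nonneg hq0.le _))

variable (c' : ℝ) in
/-- `Step15_u032` — `_holds` alias of `step15_u032_holds` above under the fact's exact name, stated under the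
prover's own binders as section variables (appended 2026-08-28, D-0026 bookkeeping: the proof term is the
existing theorem of this file; no statement, definition or attribute is edited; no new named fact; the
ledger's debt table listed the fact unproved). [cite: Zhang2022LandauSiegel, §15 p. 84] -/
theorem _root_.Literature.NumberTheory.LFunctions.Zhang2022.Typed.Section15B.Step15_u032_holds :
    _root_.Literature.NumberTheory.LFunctions.Zhang2022.Typed.Section15B.Step15_u032 c' :=
  _root_.Literature.NumberTheory.LFunctions.Zhang2022.Typed.Section15B.step15_u032_holds (c' := c')

/-- **§15.u034 ("… is analytic … for `σ > 9/10`") holds outright** (DAG `Z22:§15.u034`, analytic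
clause, [Z22 p.84, tex L4205–L4212]): the Euler product `𝓜₁(d,l;s) = ∏'_q calM1Factor` converges and
is holomorphic on `σ > 9/10` — the tree's edge `step15_u034an_of` (`Section15BCalM1Analytic`) fed with
`step15_u032_holds` (this file) and `step15_u033_holds` (`Section15BLocalEstimates`).
[cite: Zhang2022LandauSiegel, §15 p. 84] -/
theorem step15_u034an_holds (c' : ℝ) : Step15_u034an c' :=
  step15_u034an_of c' (step15_u032_holds c') (step15_u033_holds c')

variable (c' : ℝ) in
/-- `Step15_u034an` — `_holds` alias of `step15_u034an_holds` above under the fact's exact name, stated under the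
prover's own binders as section variables (appended 2026-08-28, D-0026 bookkeeping: the proof term is the
existing theorem of this file; no statement, definition or attribute is edited; no new named fact; the
ledger's debt table listed the fact unproved). [cite: Zhang2022LandauSiegel, §15 p. 84] -/
theorem _root_.Literature.NumberTheory.LFunctions.Zhang2022.Typed.Section15B.Step15_u034an_holds :
    _root_.Literature.NumberTheory.LFunctions.Zhang2022.Typed.Section15B.Step15_u034an c' :=
  _root_.Literature.NumberTheory.LFunctions.Zhang2022.Typed.Section15B.step15_u034an_holds (c' := c')

end Literature.NumberTheory.LFunctions.Zhang2022.Typed.Section15B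

end
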